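import Summits.QuantumFields.GaugeBoot.TiltedBoxLimitHaarShift
import Literature.MathematicalPhysics.QuantumLattice.LatticeGaugeDLRGibbsProofs
import HarnessLib

/-!
# Infinite-volume limit points of the 45°-tilted boxes, part 9: the boxes satisfy the local DLR equations

HONEST FRAMING (cell `pub-gaugeboot`, page 1 of every file): the venture produces certified bounds
on lattice expectations at stated coupling, gauge group, dimension and torus size; NOT a mass gap,
NOT a continuum limit, NOT a string tension; NOT Yang–Mills-summit-bearing (barriers
`FixedCouplingUltralocality`, `PerturbativeInvisibility`). Bookkeeping towards "tilted limit points
are DLR states" (`TiltedBoxLimitDLR.lean`); nothing else is claimed.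

## Content

**`integral_tiltedLift_eq_integral_ymSpecification`** — the tilted-box analogue of the tree's torus
lemma `wilsonExpectation_toTorusObservable_eq` (`LatticeGaugeDLRGibbsProofs.lean`): for a finite
edge set `Λ` of `ℤ^d`, a bounded continuous cylinder observable `F` with support `S₀`, and a box
`ℤ^d/Γ(M_u, M_v, L)` whose quotient map is injective on the base points of `Λ ∪ S₀ ∪ ∂Λ` (`∂Λ` the
edges of the plaquettes touching `Λ`), the box Wilson state gives the same expectation to
`F ∘ tiltedLift` and to `(γ_Λ F) ∘ tiltedLift`, `γ_Λ = ymSpecification ρ β Λ` the lattice Yang–Mills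
kernel: the conditional law of the box links below `Λ` given the others is the Wilson kernel, whose
plaquettes and boundary links inject into the box. Ingredients: the near/far split of the box action
(`sum_image_mk_plaquetteTerm` of part 6, `holonomy_piecewise_of_ne`), the lift of a resampled box
configuration (`tiltedLift_piecewise_apply`), and the tree's abstract finite-volume DLR identity
`integral_exp_mul_eq_integral_exp_mul_condAvg` and reindexing lemma `pi_map_comp_injective`.

References: H.-O. Georgii, Gibbs Measures and Phase Transitions (2011), proof of Thm. 4.17;
S. Friedli, Y. Velenik (2017) §6.3 (6.34); E. Seiler, LNP 159 (1982) Ch. 2.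
-/

noncomputable section

open MeasureTheory Filter Topology Finset
open Literature.Probability.LatticeModels (Site glueWith glueWith_apply_mem glueWith_apply_not_mem)
open Literature.MathematicalPhysics.QuantumLattice
open Literature.MathematicalPhysics.QuantumFieldTheory (haarProbability)
open Literature.RepresentationTheory.CompactGroups

namespace Summit.QuantumFields.GaugeBoot

namespace TiltedRP

section Lattice

variable {d : ℕ} {i j : Fin d} {Mu Mv L N : ℕ} {G : Type*} [Group G]
variable (ρ : G →* Matrix (Fin N) (Fin N) ℂ)

omit [Group G] in
/-- A box plaquette one of whose four links is the class of an edge `e ∈ Λ` is the class of a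
plaquette of `ℤ^d` touching `Λ` (the `Λ`-version of `exists_mk_eq_of_tiltedEdge_eq`). -/
theorem exists_mk_eq_of_tiltedEdge_eq_of_mem {Λ : Finset (ZdEdge d)} {e : ZdEdge d} (he : e ∈ Λ)
    (q : Plaq (TiltedSite d i j Mu Mv L) d)
    (hq : tiltedEdge d i j Mu Mv L e = (q.1, q.2.1.1) ∨
      tiltedEdge d i j Mu Mv L e = (q.1 + tiltedUnit d i j Mu Mv L q.2.1.1, q.2.1.2) ∨
      tiltedEdge d i j Mu Mv L e = (q.1 + tiltedUnit d i j Mu Mv L q.2.1.2, q.2.1.1) ∨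
      tiltedEdge d i j Mu Mv L e = (q.1, q.2.1.2)) :
    ∃ p ∈ plaquettesTouching Λ,
      (((p.1 : TiltedSite d i j Mu Mv L), p.2) : Plaq (TiltedSite d i j Mu Mv L) d) = q := by
  obtain ⟨p, hp, hpq⟩ := exists_mk_eq_of_tiltedEdge_eq (Mu := Mu) (Mv := Mv) (L := L) e q hq
  refine ⟨p, ?_, hpq⟩
  obtain ⟨e', he'⟩ := mem_plaquettesTouching_iff.1 hp
  rw [mem_inter, mem_singleton] at he'
  exact mem_plaquettesTouching_iff.2 ⟨e, mem_inter.2 ⟨he'.2 ▸ he'.1, he⟩⟩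

/-- **Far part**: a box plaquette which is not the class of a plaquette touching `Λ` has no link in
`Λ.image tiltedEdge`, so its holonomy is unchanged when those links are resampled. -/
theorem holonomy_piecewise_of_ne [DecidableEq (TiltedSite d i j Mu Mv L)] {Λ : Finset (ZdEdge d)}
    {q : Plaq (TiltedSite d i j Mu Mv L) d}
    (hq : ∀ p ∈ plaquettesTouching Λ,
      (((p.1 : TiltedSite d i j Mu Mv L), p.2) : Plaq (TiltedSite d i j Mu Mv L) d) ≠ q)
    (W V : Config (TiltedSite d i j Mu Mv L) d G) :
    holonomy (tiltedUnit d i j Mu Mv L) ((Λ.image (tiltedEdge d i j Mu Mv L)).piecewise W V) q.1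
        q.2.1.1 q.2.1.2 = holonomy (tiltedUnit d i j Mu Mv L) V q.1 q.2.1.1 q.2.1.2 := by
  have key : ∀ l : Link (TiltedSite d i j Mu Mv L) d,
      (l = (q.1, q.2.1.1) ∨ l = (q.1 + tiltedUnit d i j Mu Mv L q.2.1.1, q.2.1.2) ∨
        l = (q.1 + tiltedUnit d i j Mu Mv L q.2.1.2, q.2.1.1) ∨ l = (q.1, q.2.1.2)) →
      (Λ.image (tiltedEdge d i j Mu Mv L)).piecewise W V l = V l := fun l hl =>
    piecewise_eq_of_notMem _ _ _ fun hmem => by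
      obtain ⟨e, he, rfl⟩ := mem_image.1 hmem
      obtain ⟨p, hp, hpq⟩ := exists_mk_eq_of_tiltedEdge_eq_of_mem he q hl
      exact hq p hp hpq
  exact holonomy_congr _ _ _ _ (key _ (Or.inl rfl)) (key _ (Or.inr (Or.inl rfl)))
    (key _ (Or.inr (Or.inr (Or.inl rfl)))) (key _ (Or.inr (Or.inr (Or.inr rfl))))

omit [Group G] in
/-- **Lift of a resampled box configuration.** On an edge set `T ⊇ Λ` on which `tiltedEdge` is
injective, lifting the box configuration whose links in `Λ.image tiltedEdge` are taken from `W`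
agrees on `T` with gluing `W ∘ tiltedEdge` on `Λ` into the lift of `V`. -/
theorem tiltedLift_piecewise_apply [DecidableEq (TiltedSite d i j Mu Mv L)] {Λ T : Finset (ZdEdge d)}
    (hΛT : Λ ⊆ T) (hinj : Set.InjOn (tiltedEdge d i j Mu Mv L) ↑T)
    (W V : Config (TiltedSite d i j Mu Mv L) d G) {e : ZdEdge d} (he : e ∈ T) :
    tiltedLift d i j Mu Mv L ((Λ.image (tiltedEdge d i j Mu Mv L)).piecewise W V) e =
      glueWith Λ (fun e' : ↥Λ => W (tiltedEdge d i j Mu Mv L e')) (tiltedLift d i j Mu Mv L V) e := by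
  simp only [tiltedLift]
  by_cases heΛ : e ∈ Λ
  · rw [piecewise_eq_of_mem _ _ _ (mem_image_of_mem _ heΛ), glueWith_apply_mem _ _ _ heΛ]
  · rw [glueWith_apply_not_mem _ _ _ heΛ, piecewise_eq_of_notMem]
    · rfl
    · intro hmem
      obtain ⟨e'', he'', h⟩ := mem_image.1 hmem
      exact heΛ (hinj (hΛT he'') he h ▸ he'')

end Lattice

/-! ## The local DLR equations on a large box -/

section Bridge

variable {d : ℕ} {i j : Fin d} {Mu Mv L N : ℕ} [NeZero Mu] [NeZero Mv] [NeZero L]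
variable {G : Type*} [Group G] [TopologicalSpace G] [IsTopologicalGroup G] [CompactSpace G]
  [MeasurableSpace G] [BorelSpace G] [SecondCountableTopology G]
variable (ρ : G →* Matrix (Fin N) (Fin N) ℂ)

omit [SecondCountableTopology G] in
/-- The box Wilson expectation as a normalised weighted product-Haar integral. -/
theorem integral_gibbs_eq_inv_mul (β : ℝ) (X : Config (TiltedSite d i j Mu Mv L) d G → ℝ) :
    ∫ V, X V ∂(gibbs ρ (tiltedUnit d i j Mu Mv L) β) =
      (∫ V, Real.exp (-β * wilsonAction ρ (tiltedUnit d i j Mu Mv L) V)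
          ∂(productHaar (TiltedSite d i j Mu Mv L) d G))⁻¹ *
        ∫ V, Real.exp (-β * wilsonAction ρ (tiltedUnit d i j Mu Mv L) V) * X V
          ∂(productHaar (TiltedSite d i j Mu Mv L) d G) := by
  rw [integral_gibbs, ← integral_const_mul]
  refine integral_congr_ae (ae_of_all _ fun V => ?_)
  simp only [smul_eq_mul]
  ring

/-- **The tilted-box Wilson states satisfy the local DLR equations of `ymSpecification`.** For a
bounded continuous cylinder observable `F` with support `S₀` and a box whose quotient map is
injective on the base points of `Λ ∪ S₀ ∪ ∂Λ`, the box state gives the same expectation to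
`F ∘ tiltedLift` and to `(γ_Λ F) ∘ tiltedLift`. -/
theorem integral_tiltedLift_eq_integral_ymSpecification (hρ : Continuous ρ) (β : ℝ)
    (Λ : Finset (ZdEdge d)) {F : LGConfig d G → ℝ} (hF : Continuous F) {C : ℝ}
    (hC : ∀ U, |F U| ≤ C) {S₀ : Finset (ZdEdge d)} (hFS : IsCylinder F S₀)
    (hinj : Set.InjOn (fun x : Site d => (x : TiltedSite d i j Mu Mv L))
      ↑((Λ ∪ S₀ ∪ (plaquettesTouching Λ).biUnion plaquetteEdges).image Prod.fst)) :
    ∫ V, F (tiltedLift d i j Mu Mv L V) ∂(gibbs ρ (tiltedUnit d i j Mu Mv L) β) =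
      ∫ V, (fun η => ∫ U, F U ∂(ymSpecification ρ β Λ η)) (tiltedLift d i j Mu Mv L V)
        ∂(gibbs ρ (tiltedUnit d i j Mu Mv L) β) := by
  classical
  set T : Finset (ZdEdge d) := Λ ∪ S₀ ∪ (plaquettesTouching Λ).biUnion plaquetteEdges with hT
  have hΛT : Λ ⊆ T := (subset_union_left).trans subset_union_left
  have hS₀T : S₀ ⊆ T := (subset_union_right).trans subset_union_left
  have hPT : (plaquettesTouching Λ).biUnion plaquetteEdges ⊆ T := subset_union_right
  have hTinj : Set.InjOn (tiltedEdge d i j Mu Mv L) ↑T := injOn_tiltedEdge hinj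
  have hPinj := injOn_mkPlaquette (i := i) (j := j) (Mu := Mu) (Mv := Mv) (L := L)
    (hinj.mono (by rw [coe_subset]; exact image_subset_image hPT))
  set mkP : ZdPlaquette d → Plaq (TiltedSite d i j Mu Mv L) d := fun p => (((p.1 : TiltedSite d i j Mu Mv L)), p.2) with hmkP
  -- near and far parts of the box action
  set a : Config (TiltedSite d i j Mu Mv L) d G → ℝ := fun V =>
    -β * ∑ q ∈ (plaquettesTouching Λ).image mkP, ((N : ℝ) - plaqObs ρ (tiltedUnit d i j Mu Mv L) q V) with ha_def
  set b : Config (TiltedSite d i j Mu Mv L) d G → ℝ := fun V =>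
    -β * ∑ q ∈ ((plaquettesTouching Λ).image mkP)ᶜ, ((N : ℝ) - plaqObs ρ (tiltedUnit d i j Mu Mv L) q V) with hb_def
  have hab : ∀ V, -β * wilsonAction ρ (tiltedUnit d i j Mu Mv L) V = a V + b V := fun V => by
    simp only [ha_def, hb_def, wilsonAction, ← mul_add, sum_add_sum_compl]
  have ha : ∀ V, a V = -β * wilsonBoundaryAction ρ Λ (tiltedLift d i j Mu Mv L V) := fun V => by
    simp only [ha_def, hmkP, sum_image_mk_plaquetteTerm ρ hPinj]
  have hb : ∀ W V, b ((Λ.image (tiltedEdge d i j Mu Mv L)).piecewise W V) = b V := fun W V => by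
    simp only [hb_def]
    congr 1
    refine sum_congr rfl fun q hq => ?_
    simp only [plaqObs]
    rw [holonomy_piecewise_of_ne (fun p hp h => (mem_compl.1 hq) (mem_image.2 ⟨p, hp, h⟩)) W V]
  have hterm : ∀ q : Plaq (TiltedSite d i j Mu Mv L) d, Continuous fun V : Config (TiltedSite d i j Mu Mv L) d G => (N : ℝ) - plaqObs ρ (tiltedUnit d i j Mu Mv L) q V :=
    fun q => continuous_const.sub (continuous_plaqObs ρ hρ (tiltedUnit d i j Mu Mv L) q)
  have hac : Continuous a := continuous_const.mul (continuous_finsetSum _ fun q _ => hterm q)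
  have hbc : Continuous b := continuous_const.mul (continuous_finsetSum _ fun q _ => hterm q)
  obtain ⟨A, hA⟩ := exists_bound_of_continuous hac
  obtain ⟨Bb, hBb⟩ := exists_bound_of_continuous hbc
  have hFt : Continuous fun V : Config (TiltedSite d i j Mu Mv L) d G => F (tiltedLift d i j Mu Mv L V) :=
    hF.comp (continuous_tiltedLift d i j Mu Mv L)
  -- transfer of the fibre integrals from `G^Λ` to the box
  have hτ : Function.Injective fun e : ↥Λ => tiltedEdge d i j Mu Mv L (e : ZdEdge d) := fun e₁ e₂ h =>
    Subtype.ext (hTinj (hΛT e₁.2) (hΛT e₂.2) h)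
  haveI : IsProbabilityMeasure (haarProbability G) :=
    CompactGroup.isProbabilityMeasure_haarMeasure_top
  have transfer : ∀ Φ : LGConfig d G → ℝ, Continuous Φ → DependsOn Φ ↑T →
      ∀ V : Config (TiltedSite d i j Mu Mv L) d G,
        ∫ ζ, Φ (glueWith Λ ζ (tiltedLift d i j Mu Mv L V))
            ∂(Measure.pi fun _ : ↥Λ => haarProbability G) =
          ∫ W, Φ (tiltedLift d i j Mu Mv L ((Λ.image (tiltedEdge d i j Mu Mv L)).piecewise W V))
            ∂(productHaar (TiltedSite d i j Mu Mv L) d G) := by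
    intro Φ hΦc hΦT V
    have hm : Measurable fun (W : Config (TiltedSite d i j Mu Mv L) d G) (e : ↥Λ) => W (tiltedEdge d i j Mu Mv L (e : ZdEdge d)) :=
      measurable_pi_iff.2 fun e => measurable_pi_apply _
    have hc : Continuous fun ζ : ↥Λ → G => Φ (glueWith Λ ζ (tiltedLift d i j Mu Mv L V)) :=
      hΦc.comp ((continuous_glueWith_prod Λ).comp
        (Continuous.prodMk_right (tiltedLift d i j Mu Mv L V)))
    rw [productHaar, ← pi_map_comp_injective (haarProbability G) hτ,
      integral_map hm.aemeasurable hc.aestronglyMeasurable]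
    refine congrArg _ (funext fun W => hΦT fun e he => ?_)
    exact (tiltedLift_piecewise_apply hΛT hTinj W V he).symm
  -- locality of the two fibre integrands
  have hST : DependsOn (wilsonBoundaryAction (G := G) ρ Λ) ↑T :=
    (isCylinder_wilsonBoundaryAction_holds (G := G) ρ Λ).mono (coe_subset.2 hPT)
  have hFT : DependsOn F ↑T := hFS.mono (coe_subset.2 hS₀T)
  have hw : Continuous fun U : LGConfig d G => Real.exp (-β * wilsonBoundaryAction ρ Λ U) :=
    Real.continuous_exp.comp (continuous_const.mul (continuous_wilsonBoundaryAction ρ hρ Λ))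
  -- the kernel average of `F` at a periodic boundary condition, computed on the box
  have key : ∀ V : Config (TiltedSite d i j Mu Mv L) d G,
      ∫ U, F U ∂(ymSpecification ρ β Λ (tiltedLift d i j Mu Mv L V)) =
        (∫ W, F (tiltedLift d i j Mu Mv L ((Λ.image (tiltedEdge d i j Mu Mv L)).piecewise W V)) *
            Real.exp (a ((Λ.image (tiltedEdge d i j Mu Mv L)).piecewise W V)) ∂(productHaar (TiltedSite d i j Mu Mv L) d G)) /
          ∫ W, Real.exp (a ((Λ.image (tiltedEdge d i j Mu Mv L)).piecewise W V)) ∂(productHaar (TiltedSite d i j Mu Mv L) d G) := by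
    intro V
    rw [integral_ymSpecification ρ hρ β Λ hF.measurable,
      transfer (fun U => F U * Real.exp (-β * wilsonBoundaryAction ρ Λ U)) (hF.mul hw)
        (fun x y h => by simp only [hFT h, hST h]),
      transfer (fun U => Real.exp (-β * wilsonBoundaryAction ρ Λ U)) hw
        (fun x y h => by simp only [hST h])]
    simp only [ha]
  -- conclude with the finite-volume DLR identity on the box
  rw [integral_gibbs_eq_inv_mul ρ β, integral_gibbs_eq_inv_mul ρ β]
  congr 1
  simp only [key, hab]
  rw [productHaar]
  exact integral_exp_mul_eq_integral_exp_mul_condAvg (haarProbability G) (Λ.image (tiltedEdge d i j Mu Mv L))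
    (F := fun V => F (tiltedLift d i j Mu Mv L V))
    (NF := fun V => ∫ W, F (tiltedLift d i j Mu Mv L ((Λ.image (tiltedEdge d i j Mu Mv L)).piecewise W V)) *
      Real.exp (a ((Λ.image (tiltedEdge d i j Mu Mv L)).piecewise W V)) ∂(Measure.pi fun _ : Link (TiltedSite d i j Mu Mv L) d => haarProbability G))
    (N1 := fun V => ∫ W, Real.exp (a ((Λ.image (tiltedEdge d i j Mu Mv L)).piecewise W V))
      ∂(Measure.pi fun _ : Link (TiltedSite d i j Mu Mv L) d => haarProbability G))
    hFt.measurable hac.measurable hbc.measurable (fun V => hC _) hA hBb hb (fun V => rfl)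
    (fun V => rfl)

end Bridge

end TiltedRP

end Summit.QuantumFields.GaugeBoot
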